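import Summits.NavierStokesRegularity.NavierStokesRegularity.Theses.ClockStretchingLaw

/-!
# Route ClockStretchingLaw — `Assembly` (item stmt-NavierStokesRegularity-10221)

Pure logic: the route statements of `ClockStretchingLaw`, in the antecedent order

  `ClockCeiling → ClockLaw → SingularZoom → NoTypeII → NoBlowupToClay → NavierStokesRegularity`,

imply Clay (A). This is, hypothesis for hypothesis, the route's deciding theorem
`Summit.NavierStokesRegularity.NavierStokesRegularity.Theses.ClockStretchingLaw.closes`; the proof
below is self-contained (it does not invoke `closes`), so that it depends only on the item
definitions.

Argument. `NoBlowupToClay` reduces `NavierStokesRegularity` to: every finite-energy (Leray–Hopf)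
classical solution on `ℝ³ × [0,T)` from a rapidly decaying datum extends smoothly past `T`. Suppose
one does not. Then it is maximal (`IsMaximalSmoothSolution = classical ∧ ¬ HasSmoothExtensionPast`,
definitional), so `NoTypeII` gives the Type-I rate near `T`. `SingularZoom` turns the Liouville-type
statement `X_sing` (no singular element of the Type-I class of KNSS-mild ancient solutions) plus the
Type-I rate into a smooth extension past `T` — so it remains to prove `X_sing`: on any element `v`
of the class that is singular at the space-time origin, `ClockLaw` gives `δ > 0` with clock
amplitude `a_v(t) ≥ δ` on `[-1,0)`, while `ClockCeiling` gives some `t ∈ [-1,0)` with `a_v(t) < δ`: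
contradiction. Nothing here is new mathematics; the open content lives in the cruxes.
-/

-- the summit and its single sub-problem share the name (CONVENTIONS §1), as in every Theorems file
set_option linter.dupNamespace false

namespace Summit.NavierStokesRegularity.NavierStokesRegularity.Theorems

open Summit.NavierStokesRegularity.NavierStokesRegularity.Theses.ClockStretchingLaw

/-- **Assembly** (item stmt-NavierStokesRegularity-10221, route ClockStretchingLaw):
`ClockCeiling → ClockLaw → SingularZoom → NoTypeII → NoBlowupToClay → NavierStokesRegularity` —
pure logic: `NoBlowupToClay` reduces Clay (A) to continuation past every `T`; a non-extendable
solution is maximal, hence Type I near `T` (`NoTypeII`); `ClockLaw` (clock amplitude bounded below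
on singular Type-I models) and `ClockCeiling` (clock amplitude not bounded below on any Type-I
model) together exclude singular Type-I models (`X_sing`), and `SingularZoom` converts `X_sing` plus
the Type-I rate into the smooth extension past `T` — contradiction. [folklore] -/
theorem clockStretchingLaw_assembly_proof :
    Summit.NavierStokesRegularity.NavierStokesRegularity.Theses.ClockStretchingLaw.Assembly := by
  unfold Assembly
  intro hA hB hZ hII hClay
  refine hClay ?_
  intro ν T hν hT u p hcl hLH hdec
  by_contra hext
  have hmax : Literature.Analysis.FluidPDE.IsMaximalSmoothSolution ν 0 u p T := ⟨hcl, hext⟩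
  have hTI : Literature.Analysis.FluidPDE.IsTypeIBlowup u T := hII ν T hν hT u p hmax hLH hdec
  refine hext (hZ ?_ ν T hν hT u p hcl hLH hdec hTI)
  intro C v hv hsing
  obtain ⟨δ, hδ, hlow⟩ := hB C v hv hsing
  obtain ⟨t, ht1, ht2, hlt⟩ := hA C v hv δ hδ
  exact absurd (hlow t ht1 ht2) (not_le.mpr hlt)

end Summit.NavierStokesRegularity.NavierStokesRegularity.Theorems
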